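import Summits.QuantumFields.BalabanUV.T4Continuum.Spine.NE3.LandauProjectionB8
import Summits.QuantumFields.BalabanUV.T4Continuum.Support.NE3CurlOfGaugeDir
import Summits.QuantumFields.BalabanUV.T4Continuum.Support.NE3HatInvCurlLetters
import HarnessLib

/-!
# T⁴ programme, node NE3 — REPAIR R24 (γ): THE LANDAU LINEAR NORMAL PART `Nn := Y + gaugeDir W λ` OF THE B8 SUPPLIER — structure (`QbarIter Nn = QbarIter Z`, `IsLandauB8 Nn`,
# skew, periodic) and its ℓ²-letters (R1), (R2) from the letters of `Y`, the covariant divergence of `Y`, and the Landau relation — k-FREE, generic in `Y`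

Cell `pub-balaban-gaps` (YM blitz, track G2, seat `ne3`, unit `pub-balaban-gaps-ne3`; writer prover-pub-balaban-gaps-ne3-g3-0, 2026-08-23), census
`run/shared/lean/pub/pub-balaban-gaps/ne/NE3.md` §4 R24.  THE OBJECT the supplier `Spine/NE3/SupplierB8.decomposedRepT_slicB8_of_landauRepB8Avg` consumes.  GENERIC IN THE FIRST SUMMAND:
`Y` is any skew periodic direction with `QbarIter L (j+1) W Y = QbarIter L (j+1) W Z` whose ℓ²-letters against `φ := QbarIter Z` and whose covariant divergence
`V ≥ Σ_y nhsNormSq (covDiv_W Y y)` are given (for the lift of the solved datum: `Spine/NE3/QbarRightInverseB8`, `CovLiftCurlLettersB8`, `CovLiftDivergenceB8`); `λ ∈ N(Q′(W))` with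
`Y + gaugeDir W λ` (1.38)-Landau (exists: `Spine/NE3/LandauProjectionB8.exists_landauB8_correction`).  THEN `Nn := Y + gaugeDir W λ` has `QbarIter Nn = QbarIter Z` (the correction is
invisible to the linearised double-bar average: `NE3LandauOrbit.QbarIter_gaugeDir` + the curved (‡) `framePotW_gaugeDir` + `bmeanIterW λ = 0`), is Landau, skew, periodic, and its
(R1)∕(R2) letters follow from `Y`'s and the correction's (`Spine/NE3/LandauProjectionB8.sum_nhsNormSq_gaugeDir_le_of_isLandauB8` + K6-Ξ Poincaré + `NE3CurlOfGaugeDir`, through `V`; the same bounds stand alone in `Spine/NE3/LandauCorrectionLettersB8`), in the regime `M²x ≤ 1`.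

CONTENT ([folklore]; 0 sorry; no `def`): §1 `QbarIter_gaugeDir_eq_zero_of_mem`, `dirSq_add_le_two`; §2 **`landauNormalPart_structure`** (skew ∧ periodic ∧ Landau ∧ `QbarIter Nn = QbarIter Z`),
**`landauNormalPart_R1`** (`dirSq Nn ≤ (2c₁ + 8·card n·c_V)·(M^d∕M²)·dirSq φ`), **`landauNormalPart_R2`** (`curlSq W Nn ≤ (2c₂ + 128·card(Plane)·card n·c_V)·(M^d∕M⁴)·dirSq φ`).

HONEST FRAMING.  ℓ²-bookkeeping over landed lemmas on OUR objects; the SUP letter and the window sup-curl of the correction summand are NOT given (finding F5: [B9] (3.42)∕(3.48) TYPE);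
nothing about Bałaban's minimisers; the chart supplier's sup letters, Π-REG, (P♮), (RES♯), the covariant root and **NE3 are NOT proved**; spine PROVED 0∕9; finite T⁴ rung (B)+1 —
NOT infinite volume, NOT mass gap, NOT `BetaPertH`, NOT Clay.  PLACEMENT: `Summits/QuantumFields/BalabanUV/T4Continuum/Spine/NE3/`; imports accepted modules only; moves nothing.
HONEST DEPENDENCY: continuum YM on T⁴ ⇐ BetaPertH ∧ nine spine estimates (0/9 proved); BetaPertH ⇐ (D1) ∧ (D4) ∧ CAP+tail; G-an2-4 gates asym, D1 and NE2/3/4.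
-/

set_option autoImplicit false

open scoped BigOperators Matrix Matrix.Norms.L2Operator
open NormedSpace Finset

namespace Summit.QuantumFields.BalabanUV.T4Continuum.NE3.NormalPartB8

open Literature.MathematicalPhysics.QuantumFieldTheory.Balaban1983to89
open B7Prop1Explicit B7Prop2Explicit MatrixNorms
open T4AveragingDeficitWall (Ad IsUnitaryCfg IsSkewDir SmallField curl curlSq dirSq dirL1)
open T4AveragingDeficitWallBoundary (IsPeriodicCfg periodBox mem_periodBox card_periodBox)
open AveragingDeficitPeriodicCounting (IsPeriodicDir)
open AveragingDeficitTwoLevelPrep (prop1Radius)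
open AveragingDeficitMultiLevelPrep (cavgIter LevelSmall tower)
open BlockAveragePushDirGauge (gaugeDir isPeriodicDir_gaugeDir)
open NE3CovariantWeitzenbock (covDiv)
open NE3CovariantBlockMean (bmeanIterW framePotW_gaugeDir)
open NE3LandauOrbit (gaugeDir_skew QbarIter_gaugeDir)
open NE3TangentCovariantTower (QbarIter framePotW)
open NE3CovariantLineSumsTower (QbarIter_add)
open NE3FramePotBoundW (tower_eq_pow_mul)
open NE3HatInvCurlLetters (curlSq_add_le)
open SpreadLift (loopRad)
open NE3.PairLandauB8 (avgKernelGauges mem_avgKernelGauges_iff IsLandauB8)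
open NE3.LandauProjectionB8 (sum_nhsNormSq_gaugeDir_le_of_isLandauB8)
open NE3CornerGaugePoincare (sum_nhsNormSq_le_four_mul_of_bmeanIterW_eq_zero)
open NE3CurlOfGaugeDir (curlSq_gaugeDir_le)

noncomputable section

variable {d : ℕ} {n : Type*} [Fintype n] [DecidableEq n]

/-! ## §1 Small lemmas -/

/-- **ON `N(Q′(W))` THE k-FOLD LINEARISED DOUBLE-BAR AVERAGE OF A GAUGE DIRECTION VANISHES**: `λ ∈ avgKernelGauges L N (j+1) W ⇒ QbarIter L (j+1) W (gaugeDir W λ) = 0`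
(`QbarIter_gaugeDir` + the curved (‡) `framePotW_gaugeDir`: the accumulated frames of `gaugeDir W λ` ARE `λ ∘ L^{j+1}•` when `bmeanIterW λ = 0`). [folklore] -/
theorem QbarIter_gaugeDir_eq_zero_of_mem [Nonempty n] {L N : ℕ} [NeZero N] (hL : 1 ≤ L) (j : ℕ) {W : Site d → Fin d → (Matrix n n ℂ)ˣ} {x : ℝ}
    (hWu : IsUnitaryCfg W) (hWP : IsPeriodicCfg W ((N * L ^ (j + 1) : ℕ) : ℤ)) (hx : 0 ≤ x) (hs : LevelSmall d L j x) (hWx : SmallField W x)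
    {lam : Site d → Matrix n n ℂ} (hlam : lam ∈ avgKernelGauges (d := d) (n := n) L N (j + 1) W) :
    QbarIter L (j + 1) W (gaugeDir W lam) = fun _ _ => 0 := by
  obtain ⟨hls, hlP, hl0⟩ := mem_avgKernelGauges_iff.mp hlam
  have hWPt : IsPeriodicCfg W ((tower L N (j + 1) : ℕ) : ℤ) := by rw [tower_eq_pow_mul, Nat.mul_comm]; exact hWP
  have hlPt : ∀ (y : Site d) (i : Fin d), lam (y + ((tower L N (j + 1) : ℕ) : ℤ) • e i) = lam y := by
    rw [tower_eq_pow_mul, Nat.mul_comm]; exact hlP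
  have h := QbarIter_gaugeDir (M := N) hL j hWu hWPt hx hs hWx hls hlPt
  have hF : framePotW L (j + 1) W (gaugeDir W lam) = fun z => lam (((L : ℤ) ^ (j + 1)) • z) := by
    funext z
    rw [framePotW_gaugeDir (M := N) hL j hWu hWPt hx hs hWx hls hlPt z, hl0]
    simp
  rw [h, hF]
  funext z κ
  simp

/-- `dirSq (Y + D) ≤ 2·dirSq Y + 2·dirSq D`. [folklore] -/
theorem dirSq_add_le_two (Y D : Site d → Fin d → Matrix n n ℂ) (F : Finset (Site d)) :
    dirSq (fun y μ => Y y μ + D y μ) F ≤ 2 * dirSq Y F + 2 * dirSq D F := by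
  unfold dirSq
  rw [Finset.mul_sum, Finset.mul_sum, ← Finset.sum_add_distrib]
  refine Finset.sum_le_sum fun y _ => ?_
  rw [Finset.mul_sum, Finset.mul_sum, ← Finset.sum_add_distrib]
  refine Finset.sum_le_sum fun μ _ => ?_
  have h := pow_le_pow_left₀ (norm_nonneg _) (norm_add_le (Y y μ) (D y μ)) 2
  nlinarith [sq_nonneg (‖Y y μ‖ - ‖D y μ‖)]

/-! ## §2 The Landau linear normal part `Nn := Y + gaugeDir W λ` -/

section NormalPart

variable [Nonempty n] {L N : ℕ} [NeZero N] (hL : 2 ≤ L) (hN : 1 ≤ N) (j : ℕ) {W : Site d → Fin d → (Matrix n n ℂ)ˣ} {x : ℝ}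
  (hWu : IsUnitaryCfg W) (hWP : IsPeriodicCfg W ((N * L ^ (j + 1) : ℕ) : ℤ)) (hx : 0 ≤ x) (hs : LevelSmall d L j x) (hWx : SmallField W x)
  (hε : ((L : ℝ) ^ (j + 1)) ^ 2 * x ≤ 1)
  (hPs : 8 * d * (((L : ℝ) ^ (j + 1)) * (((d : ℝ) - 1) * (((L : ℝ) ^ (j + 1)) - 1) * x)) ^ 2
    + 2 * (Fintype.card n * (4 * (d : ℝ) ^ 2 * ((L : ℝ) ^ (j + 1) - 1) ^ 2 * x + 16 * d * loopRad d L ((prop1Radius d L)^[j] x)) ^ 2)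
      ≤ 1 / 2)
  {Z Y : Site d → Fin d → Matrix n n ℂ} (hYs : IsSkewDir Y) (hYP : IsPeriodicDir Y ((N * L ^ (j + 1) : ℕ) : ℤ))
  (hYQ : QbarIter L (j + 1) W Y = QbarIter L (j + 1) W Z)
  {lam : Site d → Matrix n n ℂ} (hlam : lam ∈ avgKernelGauges (d := d) (n := n) L N (j + 1) W)
  (hLan : IsLandauB8 (d := d) L N (j + 1) W (fun y κ => Y y κ + gaugeDir W lam y κ))
  {V cV c₁ c₂ : ℝ} (hV : ∑ y ∈ periodBox (d := d) (N * L ^ (j + 1)), nhsNormSq (covDiv W Y y) ≤ V)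
  (hcV : 0 ≤ cV) (hVφ : V ≤ cV * (((L : ℝ) ^ (j + 1)) ^ d / ((L : ℝ) ^ (j + 1)) ^ 4) * dirSq (QbarIter L (j + 1) W Z) (periodBox (d := d) N))
  (hY1 : dirSq Y (periodBox (d := d) (N * L ^ (j + 1))) ≤ c₁ * (((L : ℝ) ^ (j + 1)) ^ d / ((L : ℝ) ^ (j + 1)) ^ 2) * dirSq (QbarIter L (j + 1) W Z) (periodBox (d := d) N))
  (hY2 : curlSq W Y (periodBox (d := d) (N * L ^ (j + 1))) ≤ c₂ * (((L : ℝ) ^ (j + 1)) ^ d / ((L : ℝ) ^ (j + 1)) ^ 4) * dirSq (QbarIter L (j + 1) W Z) (periodBox (d := d) N))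

include hL hWu hWP hx hs hWx hYs hYP hYQ hlam hLan in
/-- **STRUCTURE**: `Nn := Y + gaugeDir W λ` is skew, `(N·L^{j+1})`-periodic, (1.38)-Landau, and `QbarIter L (j+1) W Nn = QbarIter L (j+1) W Z`. [folklore] -/
theorem landauNormalPart_structure :
    IsSkewDir (fun y μ => Y y μ + gaugeDir W lam y μ) ∧ IsPeriodicDir (fun y μ => Y y μ + gaugeDir W lam y μ) ((N * L ^ (j + 1) : ℕ) : ℤ) ∧
      IsLandauB8 (d := d) L N (j + 1) W (fun y μ => Y y μ + gaugeDir W lam y μ) ∧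
      QbarIter L (j + 1) W (fun y μ => Y y μ + gaugeDir W lam y μ) = QbarIter L (j + 1) W Z := by
  have hL1 : 1 ≤ L := by omega
  obtain ⟨hls, hlP, -⟩ := mem_avgKernelGauges_iff.mp hlam
  refine ⟨fun y μ => (skewAdjoint (Matrix n n ℂ)).add_mem (hYs y μ) (gaugeDir_skew hWu hls y μ), fun y κ μ => ?_, hLan, ?_⟩
  · show Y (y + _) μ + gaugeDir W lam (y + _) μ = Y y μ + gaugeDir W lam y μ
    rw [hYP y κ μ, isPeriodicDir_gaugeDir hWP hlP y κ μ]
  · rw [QbarIter_add hL1 j hWu hx hs hWx, hYQ, QbarIter_gaugeDir_eq_zero_of_mem hL1 j hWu hWP hx hs hWx hlam]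
    funext z κ; simp

include hL hN hWu hWP hx hs hWx hPs hYP hlam hLan hV hVφ hY1 in
omit [NeZero N] in
/-- **(R1)**: `dirSq Nn (periodBox (N·M)) ≤ (2c₁ + 8·card n·c_V)·(M^d∕M²)·dirSq φ (periodBox N)` (`dirSq (gaugeDir W λ) ≤ card n·4M²·V`). [folklore] -/
theorem landauNormalPart_R1 :
    dirSq (fun y μ => Y y μ + gaugeDir W lam y μ) (periodBox (d := d) (N * L ^ (j + 1)))
      ≤ (2 * c₁ + 8 * Fintype.card n * cV) * (((L : ℝ) ^ (j + 1)) ^ d / ((L : ℝ) ^ (j + 1)) ^ 2) * dirSq (QbarIter L (j + 1) W Z) (periodBox (d := d) N) := by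
  set M : ℝ := (L : ℝ) ^ (j + 1) with hMdef
  have hM0 : 0 < M := by rw [hMdef]; positivity
  set Dφ : ℝ := dirSq (QbarIter L (j + 1) W Z) (periodBox (d := d) N) with hDφ
  have hDφ0 : 0 ≤ Dφ := by rw [hDφ]; unfold dirSq; positivity
  -- the correction in ℓ²: op-norm² ≤ card n · nhs², then γ3's letter `Σ nhsNormSq (gaugeDir W λ) ≤ 4M²·V`
  have hG := sum_nhsNormSq_gaugeDir_le_of_isLandauB8 hL hN j hWu hWP hx hs hWx hPs hYP hlam hLan
  have hD1 : dirSq (gaugeDir W lam) (periodBox (d := d) (N * L ^ (j + 1)))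
      ≤ Fintype.card n * (4 * ((L : ℝ) ^ (j + 1)) ^ 2 * ∑ y ∈ periodBox (d := d) (N * L ^ (j + 1)), nhsNormSq (covDiv W Y y)) := by
    unfold dirSq
    calc ∑ y ∈ periodBox (d := d) (N * L ^ (j + 1)), ∑ κ : Fin d, ‖gaugeDir W lam y κ‖ ^ 2
        ≤ ∑ y ∈ periodBox (d := d) (N * L ^ (j + 1)), ∑ κ : Fin d, Fintype.card n * nhsNormSq (gaugeDir W lam y κ) :=
          Finset.sum_le_sum fun y _ => Finset.sum_le_sum fun κ _ => opNorm_sq_le_card_mul_nhsNormSq _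
      _ = Fintype.card n * ∑ y ∈ periodBox (d := d) (N * L ^ (j + 1)), ∑ κ : Fin d, nhsNormSq (gaugeDir W lam y κ) := by
          rw [Finset.mul_sum]; exact Finset.sum_congr rfl fun y _ => by rw [Finset.mul_sum]
      _ ≤ _ := mul_le_mul_of_nonneg_left hG (Nat.cast_nonneg _)
  have hD1' : dirSq (gaugeDir W lam) (periodBox (d := d) (N * L ^ (j + 1))) ≤ Fintype.card n * (4 * M ^ 2 * (cV * (M ^ d / M ^ 4) * Dφ)) :=
    hD1.trans (mul_le_mul_of_nonneg_left (mul_le_mul_of_nonneg_left (hV.trans hVφ) (by positivity)) (Nat.cast_nonneg _))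
  have hsum := dirSq_add_le_two Y (gaugeDir W lam) (periodBox (d := d) (N * L ^ (j + 1)))
  refine hsum.trans ?_
  have h := add_le_add (mul_le_mul_of_nonneg_left hY1 (by norm_num : (0:ℝ) ≤ 2)) (mul_le_mul_of_nonneg_left hD1' (by norm_num : (0:ℝ) ≤ 2))
  refine h.trans (le_of_eq ?_)
  field_simp
  ring

include hL hN hWu hWP hx hs hWx hε hPs hYP hlam hLan hV hcV hVφ hY2 in
omit [NeZero N] in
/-- **(R2)**: `curlSq W Nn (periodBox (N·M)) ≤ (2c₂ + 128·card(Plane)·card n·c_V)·(M^d∕M⁴)·dirSq φ (periodBox N)` (`curlSq (gaugeDir W λ) ≤ 4x²·card(Plane)·card n·16M⁴·V` and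
`x²M⁴ ≤ 1`). [folklore] -/
theorem landauNormalPart_R2 :
    curlSq W (fun y μ => Y y μ + gaugeDir W lam y μ) (periodBox (d := d) (N * L ^ (j + 1)))
      ≤ (2 * c₂ + 128 * Fintype.card (T4AveragingDeficitWall.Plane d) * Fintype.card n * cV)
          * (((L : ℝ) ^ (j + 1)) ^ d / ((L : ℝ) ^ (j + 1)) ^ 4) * dirSq (QbarIter L (j + 1) W Z) (periodBox (d := d) N) := by
  set M : ℝ := (L : ℝ) ^ (j + 1) with hMdef
  have hM0 : 0 < M := by rw [hMdef]; positivity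
  set Dφ : ℝ := dirSq (QbarIter L (j + 1) W Z) (periodBox (d := d) N) with hDφ
  have hDφ0 : 0 ≤ Dφ := by rw [hDφ]; unfold dirSq; positivity
  -- the correction's curl: `curlSq (gaugeDir W λ) ≤ 4x²·card(Plane)·Σ‖λ‖²`, `Σ‖λ‖² ≤ card n·4M²·Σ nhsNormSq (gaugeDir W λ) ≤ card n·16M⁴·V`
  obtain ⟨hls, hlP, hl0⟩ := mem_avgKernelGauges_iff.mp hlam
  have hG := sum_nhsNormSq_gaugeDir_le_of_isLandauB8 hL hN j hWu hWP hx hs hWx hPs hYP hlam hLan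
  have hξ : ∀ z ∈ periodBox (d := d) N, bmeanIterW L (j + 1) W lam z = 0 := fun z _ => by simp only [hl0, Pi.zero_apply]
  have hPo := sum_nhsNormSq_le_four_mul_of_bmeanIterW_eq_zero hL j hWu hx hs hWx N lam hξ hPs
  rw [Nat.mul_comm] at hPo
  have hΛ : ∑ y ∈ periodBox (d := d) (N * L ^ (j + 1)), ‖lam y‖ ^ 2
      ≤ Fintype.card n * (16 * ((L : ℝ) ^ (j + 1)) ^ 4 * ∑ y ∈ periodBox (d := d) (N * L ^ (j + 1)), nhsNormSq (covDiv W Y y)) := by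
    calc ∑ y ∈ periodBox (d := d) (N * L ^ (j + 1)), ‖lam y‖ ^ 2
        ≤ ∑ y ∈ periodBox (d := d) (N * L ^ (j + 1)), Fintype.card n * nhsNormSq (lam y) := Finset.sum_le_sum fun y _ => opNorm_sq_le_card_mul_nhsNormSq _
      _ = Fintype.card n * ∑ y ∈ periodBox (d := d) (N * L ^ (j + 1)), nhsNormSq (lam y) := by rw [Finset.mul_sum]
      _ ≤ Fintype.card n * (4 * (((L : ℝ) ^ (j + 1)) ^ 2 * (4 * ((L : ℝ) ^ (j + 1)) ^ 2 * ∑ y ∈ periodBox (d := d) (N * L ^ (j + 1)), nhsNormSq (covDiv W Y y)))) :=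
          mul_le_mul_of_nonneg_left (hPo.trans (mul_le_mul_of_nonneg_left (mul_le_mul_of_nonneg_left hG (by positivity)) (by norm_num))) (Nat.cast_nonneg _)
      _ = _ := by ring
  have hD2 : curlSq W (gaugeDir W lam) (periodBox (d := d) (N * L ^ (j + 1)))
      ≤ 4 * x ^ 2 * Fintype.card (T4AveragingDeficitWall.Plane d)
          * (Fintype.card n * (16 * ((L : ℝ) ^ (j + 1)) ^ 4 * ∑ y ∈ periodBox (d := d) (N * L ^ (j + 1)), nhsNormSq (covDiv W Y y))) :=
    (curlSq_gaugeDir_le hWu hWx lam (periodBox (d := d) (N * L ^ (j + 1)))).trans (mul_le_mul_of_nonneg_left hΛ (by positivity))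
  have hx4 : x ^ 2 * M ^ 4 ≤ 1 := by
    have h1 : 0 ≤ M ^ 2 * x := by positivity
    have h2 : M ^ 2 * x ≤ 1 := by rw [hMdef]; exact hε
    nlinarith [h1, h2]
  have hT0 : 0 ≤ Fintype.card (T4AveragingDeficitWall.Plane d) * (Fintype.card n * (16 * (cV * (M ^ d / M ^ 4) * Dφ))) := by positivity
  have hD2' : curlSq W (gaugeDir W lam) (periodBox (d := d) (N * L ^ (j + 1)))
      ≤ 64 * Fintype.card (T4AveragingDeficitWall.Plane d) * Fintype.card n * cV * (M ^ d / M ^ 4) * Dφ := by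
    have h1 : curlSq W (gaugeDir W lam) (periodBox (d := d) (N * L ^ (j + 1)))
        ≤ 4 * x ^ 2 * Fintype.card (T4AveragingDeficitWall.Plane d) * (Fintype.card n * (16 * M ^ 4 * (cV * (M ^ d / M ^ 4) * Dφ))) :=
      hD2.trans (mul_le_mul_of_nonneg_left (mul_le_mul_of_nonneg_left (mul_le_mul_of_nonneg_left (hV.trans hVφ) (by positivity)) (Nat.cast_nonneg _))
        (by positivity))
    refine h1.trans ?_
    have : 4 * x ^ 2 * Fintype.card (T4AveragingDeficitWall.Plane d) * (Fintype.card n * (16 * M ^ 4 * (cV * (M ^ d / M ^ 4) * Dφ)))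
        = (x ^ 2 * M ^ 4) * (4 * (Fintype.card (T4AveragingDeficitWall.Plane d) * (Fintype.card n * (16 * (cV * (M ^ d / M ^ 4) * Dφ))))) := by ring
    rw [this]
    nlinarith [mul_le_mul_of_nonneg_right hx4 (mul_nonneg (by norm_num : (0:ℝ) ≤ 4) hT0)]
  have hsum := curlSq_add_le W Y (gaugeDir W lam) (periodBox (d := d) (N * L ^ (j + 1)))
  have heq : curlSq W (fun y μ => Y y μ + gaugeDir W lam y μ) (periodBox (d := d) (N * L ^ (j + 1)))
      = curlSq W (Y + gaugeDir W lam) (periodBox (d := d) (N * L ^ (j + 1))) := rfl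
  rw [heq]
  refine hsum.trans ?_
  have h := add_le_add (mul_le_mul_of_nonneg_left hY2 (by norm_num : (0:ℝ) ≤ 2)) (mul_le_mul_of_nonneg_left hD2' (by norm_num : (0:ℝ) ≤ 2))
  refine h.trans (le_of_eq ?_)
  ring

end NormalPart

end

end Summit.QuantumFields.BalabanUV.T4Continuum.NE3.NormalPartB8
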